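import Mathlib
import Summits.Ventures.HodgeRepro2.HeckeFiniteIndex
import Summits.Ventures.HodgeRepro2.MultiplicityOnePeriod

/-!
# HeckeSlashDoubleCoset — the Hecke operator `T_δ` depends only on the double coset `SδS`

Blind cell `pub-hodge-repro2`, seat p2 (Tier 5 kernel support, Hecke side).

`HeckeSlashOperator.lean` (row 114) defines `T_δ f = Σ_{q ∈ S/S_δ} f ∥_k (δ r_q)` with
`r_q = (out q)⁻¹`. Classically `T_δ` is the sum over the right cosets `Sα ⊆ SδS` of `f ∥ α`, so it
depends on `δ` only through the double coset `SδS`. This file proves that in kernel: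

* `slash_realEmbedding_mul_left`: for `γ ∈ S`, `f ∥ (γα) = f ∥ α` on the ball (weight-`k`
  invariance + the cocycle `slash_mul`) — `f ∥ α` depends only on the right coset `Sα`;
* `rightCoset_heckeRep_eq_iff`: `q ↦ S δ r_q` is injective; `exists_heckeRep_mem_rightCoset`:
  every element of `SδS` lies in some `S δ r_q`;
* **`hecke_eq_of_doubleCoset_eq`**: if `SδS = Sδ'S` then `T_δ f = T_{δ'} f` on the ball
  (`Finset.sum_nbij` along the induced bijection `S/S_δ ≃ S/S_{δ'}`);
* **`heckeFamilyOf_eq_of_doubleCoset_eq`** / **`heckeFamilyOf_eq_inv_of_doubleCoset_eq`**: the same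
  for the operators on the Petersson space — in particular `T_δ = T_{δ⁻¹}` when `SδS = Sδ⁻¹S`,
  the hypothesis of `exists_orthonormalBasis_heckeSpace_holomorphic_of_self_adjoint`.
-/

namespace Summit.Ventures.HodgeRepro2.ShimuraData

open Finset

variable {K : Type*} [Field K] [NumberField K] [NumberField.IsCMField K] {τ₁ : K →+* ℂ}
  {H : Matrix (Fin 3) (Fin 3) K} {Q : Matrix (Fin 3) (Fin 3) ℂ}

/-- The double coset `S δ S` as a set of matrices. -/
def doubleCoset (S : Subgroup (GL (Fin 3) K)) (δ : GL (Fin 3) K) : Set (GL (Fin 3) K) :=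
  {x | ∃ s₁ ∈ S, ∃ s₂ ∈ S, x = s₁ * δ * s₂}

omit [NumberField K] [NumberField.IsCMField K] in
/-- `δ * r_q ∈ S δ S`. -/
theorem mul_heckeRep_mem_doubleCoset (S : Subgroup (GL (Fin 3) K)) (δ : GL (Fin 3) K)
    [Fintype (S ⧸ (heckeSubgroup S δ).subgroupOf S)] (q : S ⧸ (heckeSubgroup S δ).subgroupOf S) :
    δ * (heckeRep S δ q : GL (Fin 3) K) ∈ doubleCoset S δ :=
  ⟨1, one_mem _, (heckeRep S δ q : GL (Fin 3) K), (heckeRep S δ q).2, by rw [one_mul]⟩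

/-- For `γ ∈ S` and `α ∈ U(H)(K)`, `f ∥_k (γ α) = f ∥_k α` on the ball (the slash of a weight-`k`
form depends only on the right coset `S α`). -/
theorem slash_realEmbedding_mul_left (hQ : IsFrame K τ₁ H Q) {S : Subgroup (GL (Fin 3) K)}
    (hS : (S : Set (GL (Fin 3) K)) ⊆ unitaryGroup K H) {k : ℕ} {f : (Fin 2 → ℂ) → ℂ}
    (hf : IsWeightFor τ₁ Q S k f) {γ : GL (Fin 3) K} (hγ : γ ∈ S) {α : GL (Fin 3) K}
    (hα : α ∈ unitaryGroup K H) {z : Fin 2 → ℂ} (hz : z ∈ ball₂) :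
    slash k (realEmbedding K τ₁ Q (γ * α)) f z = slash k (realEmbedding K τ₁ Q α) f z := by
  have hαU : IsInU21 (realEmbedding K τ₁ Q α) := hQ.isInU21_realEmbedding hα
  have hγU : IsInU21 (realEmbedding K τ₁ Q γ) := hQ.isInU21_realEmbedding (hS hγ)
  rw [hQ.realEmbedding_mul, slash_mul k hαU f hz]
  have hw : ballAction (realEmbedding K τ₁ Q α) z ∈ ball₂ := hαU.ballAction_mem_ball₂ hz
  have hfix : slash k (realEmbedding K τ₁ Q γ) f (ballAction (realEmbedding K τ₁ Q α) z)
      = f (ballAction (realEmbedding K τ₁ Q α) z) :=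
    (slash_eq_self_iff (hγU.autFactor_ne_zero hw)).mpr (hf γ hγ _ hw)
  show (autFactor (realEmbedding K τ₁ Q α) z ^ k)⁻¹
      * slash k (realEmbedding K τ₁ Q γ) f (ballAction (realEmbedding K τ₁ Q α) z)
    = slash k (realEmbedding K τ₁ Q α) f z
  rw [hfix]
  rfl

section cosets

variable (S : Subgroup (GL (Fin 3) K)) (δ : GL (Fin 3) K)
  [Fintype (S ⧸ (heckeSubgroup S δ).subgroupOf S)]

omit [NumberField K] [NumberField.IsCMField K] [Fintype (S ⧸ (heckeSubgroup S δ).subgroupOf S)] in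
/-- `S δ r_q = S δ r_{q'}` (i.e. `δ r_q (δ r_{q'})⁻¹ ∈ S`) iff `q = q'`. -/
theorem rightCoset_heckeRep_eq_iff (q q' : S ⧸ (heckeSubgroup S δ).subgroupOf S) :
    δ * (heckeRep S δ q : GL (Fin 3) K) * (δ * (heckeRep S δ q' : GL (Fin 3) K))⁻¹ ∈ S ↔ q = q' := by
  set x : S := (Quotient.out q)⁻¹ * Quotient.out q' with hxdef
  have hx : δ * (heckeRep S δ q : GL (Fin 3) K) * (δ * (heckeRep S δ q' : GL (Fin 3) K))⁻¹
      = δ * (x : GL (Fin 3) K) * δ⁻¹ := by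
    simp only [hxdef, heckeRep, Subgroup.coe_mul, Subgroup.coe_inv, mul_inv_rev, inv_inv]
    group
  rw [hx]
  constructor
  · intro h
    have hmem : x ∈ (heckeSubgroup S δ).subgroupOf S := by
      rw [Subgroup.mem_subgroupOf, mem_heckeSubgroup]
      exact ⟨x.2, h⟩
    have := (QuotientGroup.eq (s := (heckeSubgroup S δ).subgroupOf S)
      (a := Quotient.out q) (b := Quotient.out q')).mpr hmem
    rwa [QuotientGroup.out_eq', QuotientGroup.out_eq'] at this
  · intro h
    subst h
    have hx1 : x = 1 := by rw [hxdef, inv_mul_cancel]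
    rw [hx1, Subgroup.coe_one, mul_one, mul_inv_cancel]
    exact one_mem _

omit [NumberField K] [NumberField.IsCMField K] [Fintype (S ⧸ (heckeSubgroup S δ).subgroupOf S)] in
/-- Every element `s₁ δ s₂` of `S δ S` lies in the right coset `S δ r_q` of `q := [s₂⁻¹]`. -/
theorem exists_heckeRep_mem_rightCoset {x : GL (Fin 3) K} (hx : x ∈ doubleCoset S δ) :
    ∃ q : S ⧸ (heckeSubgroup S δ).subgroupOf S,
      x * (δ * (heckeRep S δ q : GL (Fin 3) K))⁻¹ ∈ S := by
  obtain ⟨s₁, hs₁, s₂, hs₂, rfl⟩ := hx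
  refine ⟨QuotientGroup.mk (⟨s₂, hs₂⟩⁻¹ : S), ?_⟩
  set q : S ⧸ (heckeSubgroup S δ).subgroupOf S := QuotientGroup.mk (⟨s₂, hs₂⟩⁻¹ : S) with hqdef
  -- `out q = s₂⁻¹ * t` with `t ∈ S_δ`
  have hout : (⟨s₂, hs₂⟩⁻¹ : S)⁻¹ * Quotient.out q ∈ (heckeSubgroup S δ).subgroupOf S := by
    rw [← QuotientGroup.eq]
    rw [QuotientGroup.out_eq']
  set t : S := (⟨s₂, hs₂⟩⁻¹ : S)⁻¹ * Quotient.out q with htdef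
  have ht : (t : GL (Fin 3) K) ∈ heckeSubgroup S δ := Subgroup.mem_subgroupOf.mp hout
  have htδ : δ * (t : GL (Fin 3) K)⁻¹ * δ⁻¹ ∈ S := by
    have := (mem_heckeSubgroup S δ).mp (inv_mem ht)
    simpa using this.2
  -- `r_q = (out q)⁻¹ = t⁻¹ * s₂`
  have hr : (heckeRep S δ q : GL (Fin 3) K) = (t : GL (Fin 3) K)⁻¹ * s₂ := by
    have h1 : Quotient.out q = ⟨s₂, hs₂⟩⁻¹ * t := by rw [htdef]; group
    simp only [heckeRep, h1, Subgroup.coe_mul, Subgroup.coe_inv, mul_inv_rev, inv_inv]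
  rw [hr]
  have : s₁ * δ * s₂ * (δ * ((t : GL (Fin 3) K)⁻¹ * s₂))⁻¹ = s₁ * (δ * (t : GL (Fin 3) K) * δ⁻¹) := by
    group
  rw [this]
  refine mul_mem hs₁ ?_
  have := (mem_heckeSubgroup S δ).mp ht
  exact this.2

end cosets

/-- **The Hecke operator depends only on the double coset.** If `S δ S = S δ' S` then
`T_δ f = T_{δ'} f` on the ball, for every weight-`k` form `f` for `S`. -/
theorem hecke_eq_of_doubleCoset_eq (hQ : IsFrame K τ₁ H Q) {S : Subgroup (GL (Fin 3) K)}
    (hS : (S : Set (GL (Fin 3) K)) ⊆ unitaryGroup K H) {δ δ' : GL (Fin 3) K}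
    (hδ' : δ' ∈ unitaryGroup K H)
    [Fintype (S ⧸ (heckeSubgroup S δ).subgroupOf S)]
    [Fintype (S ⧸ (heckeSubgroup S δ').subgroupOf S)]
    (hdc : doubleCoset S δ = doubleCoset S δ') {k : ℕ} {f : (Fin 2 → ℂ) → ℂ}
    (hf : IsWeightFor τ₁ Q S k f) {z : Fin 2 → ℂ} (hz : z ∈ ball₂) :
    hecke S δ τ₁ Q k f z = hecke S δ' τ₁ Q k f z := by
  classical
  -- the reindexing map `i : S/S_δ → S/S_{δ'}`: `S δ r_q = S δ' r_{i q}`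
  have hmem : ∀ q : S ⧸ (heckeSubgroup S δ).subgroupOf S,
      δ * (heckeRep S δ q : GL (Fin 3) K) ∈ doubleCoset S δ' := fun q =>
    hdc ▸ mul_heckeRep_mem_doubleCoset S δ q
  choose i hi using fun q => exists_heckeRep_mem_rightCoset S δ' (hmem q)
  -- `hi q : δ r_q (δ' r_{i q})⁻¹ ∈ S`
  have hinj : Function.Injective i := by
    intro q q' hqq'
    rw [← rightCoset_heckeRep_eq_iff S δ]
    have h1 := hi q
    have h2 := hi q'
    rw [hqq'] at h1
    -- `δ r_q (δ' r_{i q'})⁻¹ ∈ S` and `δ r_{q'} (δ' r_{i q'})⁻¹ ∈ S` ⇒ `δ r_q (δ r_{q'})⁻¹ ∈ S`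
    have := mul_mem h1 (inv_mem h2)
    simpa only [mul_inv_rev, inv_inv, mul_assoc, inv_mul_cancel_left] using this
  have hsurj : Function.Surjective i := by
    intro q'
    have hmem' : δ' * (heckeRep S δ' q' : GL (Fin 3) K) ∈ doubleCoset S δ :=
      hdc ▸ mul_heckeRep_mem_doubleCoset S δ' q'
    obtain ⟨q, hq⟩ := exists_heckeRep_mem_rightCoset S δ hmem'
    refine ⟨q, ?_⟩
    rw [← rightCoset_heckeRep_eq_iff S δ']
    -- `δ' r_{i q} ~ δ r_q ~ δ' r_{q'}`
    have h1 := hi q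
    have := mul_mem (inv_mem h1) (inv_mem hq)
    simpa only [mul_inv_rev, inv_inv, mul_assoc, inv_mul_cancel_left] using this
  -- the terms agree
  have hterm : ∀ q : S ⧸ (heckeSubgroup S δ).subgroupOf S,
      slash k (realEmbedding K τ₁ Q (δ * (heckeRep S δ q : GL (Fin 3) K))) f z
        = slash k (realEmbedding K τ₁ Q (δ' * (heckeRep S δ' (i q) : GL (Fin 3) K))) f z := by
    intro q
    set γ : GL (Fin 3) K := δ * (heckeRep S δ q : GL (Fin 3) K)
      * (δ' * (heckeRep S δ' (i q) : GL (Fin 3) K))⁻¹ with hγdef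
    have hγ : γ ∈ S := hi q
    have hα : δ' * (heckeRep S δ' (i q) : GL (Fin 3) K) ∈ unitaryGroup K H :=
      mul_mem hδ' (hS (heckeRep S δ' (i q)).2)
    have hγα : γ * (δ' * (heckeRep S δ' (i q) : GL (Fin 3) K))
        = δ * (heckeRep S δ q : GL (Fin 3) K) := by
      rw [hγdef]; group
    rw [← hγα]
    exact slash_realEmbedding_mul_left hQ hS hf hγ hα hz
  simp only [hecke]
  exact Finset.sum_nbij i (fun q _ => Finset.mem_univ _) hinj.injOn
    (fun q' _ => by obtain ⟨q, rfl⟩ := hsurj q'; exact ⟨q, Finset.mem_univ _, rfl⟩) fun q _ => hterm q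

section petersson

variable (hQ : IsFrame K τ₁ H Q) (S : Subgroup (GL (Fin 3) K))
  (hS : (S : Set (GL (Fin 3) K)) ⊆ unitaryGroup K H) [CompactSpace (ballQuotient hQ S hS)]
  {D : Set ball₂} (k : ℕ) (hD : IsBallFundamentalDomain hQ S hS D) (hDm : MeasurableSet D)
  (inst : ∀ δ : unitaryGroup K H, Fintype (S ⧸ (heckeSubgroup S (δ : GL (Fin 3) K)).subgroupOf S))

/-- **On the Petersson space, `T_δ` depends only on the double coset.** -/
theorem heckeFamilyOf_eq_of_doubleCoset_eq {δ δ' : unitaryGroup K H}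
    (hdc : doubleCoset S (δ : GL (Fin 3) K) = doubleCoset S (δ' : GL (Fin 3) K)) :
    heckeFamilyOf hQ S hS k hD hDm inst δ = heckeFamilyOf hQ S hS k hD hDm inst δ' := by
  refine LinearMap.ext ?_
  rintro ⟨f⟩
  letI := inst δ
  letI := inst δ'
  letI := inst δ⁻¹
  letI := inst δ'⁻¹
  change (SeparationQuotient.mk (heckeForms hQ S hS k hD δ.2 f) : PeterssonSpace hQ S hS k hD)
    = SeparationQuotient.mk (heckeForms hQ S hS k hD δ'.2 f)
  rw [PeterssonSpace.mk_eq_mk_iff]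
  intro z hz
  have h1 := heckeForms_apply_coe hQ S hS k hD δ.2 f
  have h2 := heckeForms_apply_coe hQ S hS k hD δ'.2 f
  rw [h1, h2]
  exact hecke_eq_of_doubleCoset_eq hQ hS δ'.2 hdc
    ((mem_weightForms τ₁ Q S k).mp (PeterssonForms.toForm hQ S hS k hD f).2).1 hz

/-- **`T_δ = T_{δ⁻¹}` when `S δ S = S δ⁻¹ S`** — the hypothesis of
`exists_orthonormalBasis_heckeSpace_holomorphic_of_self_adjoint` as a double-coset condition. -/
theorem heckeFamilyOf_eq_inv_of_doubleCoset_eq {δ : unitaryGroup K H}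
    (hdc : doubleCoset S (δ : GL (Fin 3) K) = doubleCoset S ((δ : GL (Fin 3) K)⁻¹)) :
    heckeFamilyOf hQ S hS k hD hDm inst δ = heckeFamilyOf hQ S hS k hD hDm inst δ⁻¹ :=
  heckeFamilyOf_eq_of_doubleCoset_eq hQ S hS k hD hDm inst (δ' := δ⁻¹) hdc

end petersson

end Summit.Ventures.HodgeRepro2.ShimuraData
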